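import Summits.BirchSwinnertonDyer.BirchSwinnertonDyer.Theorems.SignedLowerHalvesSmallImageLowerHalfBothSignsRttKanLayerDepletion
import Literature.NumberTheory.EllipticCurves.MazurTateElementCoeffField
import Literature.NumberTheory.EllipticCurves.SharpFlatPAdicLFunctionCoeffField
import Summits.BirchSwinnertonDyer.BirchSwinnertonDyer.Theorems.ResidualThetaTransportAtTwoThetaLayerLambdaCongruenceAtTwoDepletionExact
import Summits.BirchSwinnertonDyer.Rank1Residual.X2.EulerFactorInvariants
import Mathlib.NumberTheory.Padics.Complex
import HarnessLib

/-!
# Route `SignedLowerHalves`, crux L `SmallImageLowerHalfBothSigns` (item stmt-BirchSwinnertonDyer-23599), line `rtt_w3`,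
# stub Kan₂ `stub_thetaLayerLambda_ns` — brick K1′: the stub's two DEPLETED LAYER POLYNOMIALS are EXACTLY the layer sums
# of the DEPLETED plus symbols (any prime `p`)

Width seat `bsd-line-slh-p3-w3` g11 under LEAD `cruxlead-stmt-BirchSwinnertonDyer-23599` g0 (cell `bsd-ssimc`). ROUTE-INDEPENDENT
helper (`--supports stmt-BirchSwinnertonDyer-23599`); THEOREMS ONLY — no definition, no named fact, no `sorry`; closes nothing;
BSD is not proved by any of this.

WHAT (port of the tree's `p = 2` file `…ThetaLayerLambdaCongruenceAtTwoDepletionExact` to an arbitrary prime, on brick K1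
`…RttKanLayerDepletion`). With `e₀ = cyclotomicExponent p`, `γ = cyclotomicGenerator p`, `μ = rootsOfUnity (torsionOrder p) ℤ_p` and
the `μ`-summed layer sum `ϑ_n(ψ) = ∑_{s mod pⁿ} (∑_{η∈μ} ψ(η̄γ^s/p^{n+e₀})) (1+X)^s`:

* §1 `natDegree_layerSum_lt'`, `layerSum_modByMonic_layerModulus'` — `deg ϑ_n < pⁿ`, so reduction mod `ω_n` fixes `ϑ_n`.
* §2 `map_mazurTateElement_eq_layerSum` — `θ_n(f)` read in `K[X]` IS `ϑ_n(algebraMap ∘ [·]⁺_f)`;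
  `map_mazurTateElementK_eq_layerSum` — `θ_n(g;Ω)^ι` IS `ϑ_n(ι ∘ [·]⁺_{g,Ω})`.
* §3 ★ `depletedCurveLayer_eq_layerSum_depletedSymbol'` — the W-side polynomial of `stub_thetaLayerLambda_ns` / AN_W,
  `(θ_n(f) · ∏_{v∈S₀} L_v(W,X) ∘ (ℓ_v⁻¹(1+X)^{e_v})) mod ω_n`, EQUALS `ϑ_n(φ^{S₀}_W)` with the DEPLETED rational plus symbol
  `φ^{S₀}_W(x) = ∑_{k : S₀ → {0,1,2}} (∏_v coeff_{k_v}(L_v) ℓ_v^{−k_v}) · [x·∏_v ℓ_v^{k_v}]⁺_f`;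
  ★ `depletedPartnerLayer_eq_layerSum_depletedSymbol'` — the g-side polynomial `(θ_n(g;Ω)^ι · ∏_v (1 − ι a_ℓ X + 𝟙_{ℓ∤M} ℓ X²) ∘
  (ℓ⁻¹(1+X)^{e_v})) mod ω_n` EQUALS `ϑ_n(φ^{S₀}_{g,Ω})`, `φ^{S₀}_{g,Ω}(x) = ∑_k (∏_v c_{v,k_v} ℓ_v^{−k_v}) · ι[x·∏ℓ_v^{k_v}]⁺_{g,Ω}`.
So Kan₂'s conclusion is a statement about the VALUES of the two depleted plus symbols at the layer-`n` sample points — where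
Vatsal's canonical-period congruence (brick K7) lives.

References: [GreenbergVatsal2000] §1 p. 9 (display (8)); [MazurTateTeitelbaum1986Invent] §I.8, §I.13; [PollackWeston2011MT] §2.1–2.2.
-/

set_option autoImplicit false
-- D-0017: single-problem summit, the namespace repeats the problem name by design.
set_option linter.dupNamespace false
noncomputable section

open scoped Classical

open Polynomial Literature.NumberTheory.EllipticCurves Literature.NumberTheory.EllipticCurves.ModularForms
  Literature.NumberTheory.EllipticCurves.GreenbergVatsal2000 Rat.HeightOneSpectrum
  Summit.BirchSwinnertonDyer.BirchSwinnertonDyer.Theorems.ThetaLayerLambdaCongruenceAtTwo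
  Summit.BirchSwinnertonDyer.Rank1Residual.X2.EulerFactorInvariants

namespace Summit.BirchSwinnertonDyer.BirchSwinnertonDyer.Theorems.SmallImageRttKan

/-! ## §1 A layer sum has degree `< q` and is fixed by reduction modulo `(1+X)^q − 1` -/

section Degree

variable {K : Type*} [Field K]

/-- A layer sum over `ℤ/q` has degree `< q` (each `(1+X)^s`, `s < q`). Port of the tree's `natDegree_layerSum_lt` (`q = 2ⁿ`).
[folklore] -/
theorem natDegree_layerSum_lt' (c : ℕ → K) (q : ℕ) [NeZero q] :
    (∑ s : ZMod q, C (c s.val) * (X + 1 : K[X]) ^ s.val).natDegree < q := by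
  have hpos : 0 < q := Nat.pos_of_ne_zero (NeZero.ne q)
  refine lt_of_le_of_lt (Polynomial.natDegree_sum_le_of_forall_le _ _ fun s _ ↦ ?_) (Nat.sub_lt hpos one_pos)
  refine (natDegree_C_mul_le _ _).trans ?_
  have h1 : (X + 1 : K[X]).natDegree ≤ 1 := by
    rw [← C_1]; exact (natDegree_add_le _ _).trans (max_le natDegree_X_le (by rw [natDegree_C]; exact zero_le_one))
  refine (natDegree_pow_le_of_le _ h1).trans ?_
  rw [mul_one]
  exact Nat.le_sub_one_of_lt (ZMod.val_lt s)

/-- `(X+1)^q − 1` is monic of degree `q` (`q > 0`). [folklore] -/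
theorem monic_layerModulus_and_natDegree (q : ℕ) [NeZero q] :
    ((X + 1 : K[X]) ^ q - 1).Monic ∧ ((X + 1 : K[X]) ^ q - 1).natDegree = q := by
  have hpos : 0 < q := Nat.pos_of_ne_zero (NeZero.ne q)
  have hX : (X + 1 : K[X]) = X + C 1 := by rw [C_1]
  have h1 : ((X + 1 : K[X]) ^ q).Monic := by rw [hX]; exact (monic_X_add_C 1).pow _
  refine ⟨?_, ?_⟩
  · apply h1.sub_of_left
    rw [degree_one, degree_eq_natDegree h1.ne_zero, hX, natDegree_pow, natDegree_X_add_C, mul_one]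
    exact_mod_cast hpos
  · rw [hX, natDegree_sub_eq_left_of_natDegree_lt] <;> rw [natDegree_pow, natDegree_X_add_C, mul_one]
    rw [natDegree_one]; exact hpos

/-- Reduction modulo `(1+X)^q − 1` leaves a layer sum over `ℤ/q` unchanged. Port of the tree's
`layerSum_modByMonic_layerModulus` (`q = 2ⁿ`). [folklore] -/
theorem layerSum_modByMonic_layerModulus' (c : ℕ → K) (q : ℕ) [NeZero q] :
    (∑ s : ZMod q, C (c s.val) * (X + 1 : K[X]) ^ s.val) %ₘ ((X + 1) ^ q - 1) =
      ∑ s : ZMod q, C (c s.val) * (X + 1 : K[X]) ^ s.val := by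
  obtain ⟨hmonic, hdeg⟩ := monic_layerModulus_and_natDegree (K := K) q
  refine (modByMonic_eq_self_iff hmonic).mpr (degree_lt_degree ?_)
  rw [hdeg]
  exact natDegree_layerSum_lt' c q

end Degree

/-! ## §2 The Mazur–Tate elements ARE `μ`-summed layer sums -/

section MazurTate

variable {p : ℕ} [hp : Fact p.Prime] {N : ℕ}

/-- **`θ_n(f)` read in `K[X]` is the `μ`-summed layer sum of `algebraMap ∘ [·]⁺_f`** (unfolding `mazurTateElement` and
commuting the finite sums). [cite: Pollack2003, Def. 6.15] [cite: MazurTateTeitelbaum1986Invent, §I.13] -/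
theorem map_mazurTateElement_eq_layerSum (f : CuspForm (CongruenceSubgroup.Gamma0 N) 2) {K : Type*} [Field K] [CharZero K]
    [Algebra ℚ K] (n : ℕ) :
    (mazurTateElement f p n).map (algebraMap ℚ K) =
      ∑ s : ZMod (p ^ n), C (∑ᶠ η : rootsOfUnity (torsionOrder p) ℤ_[p],
        algebraMap ℚ K (ratPlusSymbol f
          (((PadicInt.toZModPow (n + cyclotomicExponent p) ((η : ℤ_[p]ˣ) : ℤ_[p]) *
            (cyclotomicGenerator p : ZMod (p ^ (n + cyclotomicExponent p))) ^ s.val).val : ℚ) /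
              (p : ℚ) ^ (n + cyclotomicExponent p)))) * (X + 1) ^ s.val := by
  haveI := neZero_torsionOrder p
  haveI : Fintype (rootsOfUnity (torsionOrder p) ℤ_[p]) := Fintype.ofFinite _
  rw [mazurTateElement, finsum_eq_sum_of_fintype, Polynomial.map_sum]
  simp_rw [Polynomial.map_sum]
  rw [Finset.sum_comm]
  refine Finset.sum_congr rfl fun s _ ↦ ?_
  rw [finsum_eq_sum_of_fintype, map_sum C, Finset.sum_mul]
  refine Finset.sum_congr rfl fun η _ ↦ ?_
  rw [Polynomial.map_mul, Polynomial.map_C, Polynomial.map_pow, Polynomial.map_add, Polynomial.map_X,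
    Polynomial.map_one]

/-- **`θ_n(g;Ω)^ι` is the `μ`-summed layer sum of `ι ∘ [·]⁺_{g,Ω}`** (unfolding `mazurTateElementK`).
[cite: PollackWeston2011MT, §2.1 (2.1) and §2.2] -/
theorem map_mazurTateElementK_eq_layerSum [NeZero N] (g : CuspForm (CongruenceSubgroup.Gamma0 N) 2) (Ω : ℂ)
    {K : Type*} [Field K] (ι : coeffField g →+* K) (n : ℕ) :
    (mazurTateElementK g Ω p n).map ι =
      ∑ s : ZMod (p ^ n), C (∑ᶠ η : rootsOfUnity (torsionOrder p) ℤ_[p],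
        ι (plusSymbolK g Ω
          (((PadicInt.toZModPow (n + cyclotomicExponent p) ((η : ℤ_[p]ˣ) : ℤ_[p]) *
            (cyclotomicGenerator p : ZMod (p ^ (n + cyclotomicExponent p))) ^ s.val).val : ℚ) /
              (p : ℚ) ^ (n + cyclotomicExponent p)))) * (X + 1) ^ s.val := by
  haveI := neZero_torsionOrder p
  haveI : Fintype (rootsOfUnity (torsionOrder p) ℤ_[p]) := Fintype.ofFinite _
  rw [mazurTateElementK, finsum_eq_sum_of_fintype, Polynomial.map_sum]
  simp_rw [Polynomial.map_sum]
  rw [Finset.sum_comm]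
  refine Finset.sum_congr rfl fun s _ ↦ ?_
  rw [finsum_eq_sum_of_fintype, map_sum C, Finset.sum_mul]
  refine Finset.sum_congr rfl fun η _ ↦ ?_
  rw [Polynomial.map_mul, Polynomial.map_C, Polynomial.map_pow, Polynomial.map_add, Polynomial.map_X,
    Polynomial.map_one]

end MazurTate

/-! ## §3 The two depleted layer polynomials of the stub are layer sums of depleted plus symbols -/

section Stub

variable {p : ℕ} [hp : Fact p.Prime]

variable {N : ℕ} [NeZero N]

/-- ★ **The curve's `S₀`-depleted layer polynomial of the stub is EXACTLY the layer sum of the `S₀`-DEPLETED rational plus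
symbol** (any prime `p`). For a cusp form `f` on `Γ₀(N)`, a curve `W/ℚ` (supplying `L_v(W,X) ∈ ℤ[X]`), a finite set `S₀` of
places not above `p`, and every layer `n`:
`(θ_n(f) · ∏_{v∈S₀} L_v(W,X) ∘ (ℓ_v⁻¹(1+X)^{e_v})) mod ω_n = ϑ_n(φ^{S₀}_W)`,
`φ^{S₀}_W(x) = ∑_{k : S₀ → {0,1,2}} (∏_v coeff_{k_v}(L_v(W,X)) ℓ_v^{−k_v}) · [x·∏_v ℓ_v^{k_v}]⁺_f`.
Port of the tree's `p = 2` theorem `depletedCurveLayer_eq_layerSum_depletedSymbol` (there with the `Δ`-doubling `C 2`).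
[cite: GreenbergVatsal2000, §1 p. 9 (display (8))] -/
theorem depletedCurveLayer_eq_layerSum_depletedSymbol' (f : CuspForm (CongruenceSubgroup.Gamma0 N) 2)
    (W : WeierstrassCurve ℚ) (n : ℕ) (S₀ : Finset (IsDedekindDomain.HeightOneSpectrum (NumberField.RingOfIntegers ℚ)))
    (hS : ∀ v ∈ S₀, natGenerator v ≠ p) :
    ((mazurTateElement f p n).map (algebraMap ℚ (PadicAlgCl p)) *
        ∏ v ∈ S₀, ((W.localPolynomialAt v).map (Int.castRingHom (PadicAlgCl p))).comp
          (C ((natGenerator v : PadicAlgCl p)⁻¹) *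
            (X + 1) ^ (PadicInt.toZModPow n (-(frobeniusExponent p (natGenerator v : ℤ_[p])))).val)) %ₘ
        ((X + 1) ^ p ^ n - 1) =
      ∑ s : ZMod (p ^ n), C (∑ᶠ η : rootsOfUnity (torsionOrder p) ℤ_[p],
        (∑ k ∈ Fintype.piFinset (fun _ : S₀ ↦ Finset.range 3),
          (∏ v : S₀, ((W.localPolynomialAt (v : IsDedekindDomain.HeightOneSpectrum (NumberField.RingOfIntegers ℚ))).map
              (Int.castRingHom (PadicAlgCl p))).coeff (k v) *
            ((natGenerator (v : IsDedekindDomain.HeightOneSpectrum (NumberField.RingOfIntegers ℚ)) : PadicAlgCl p)⁻¹) ^ (k v)) *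
          algebraMap ℚ (PadicAlgCl p) (ratPlusSymbol f
            ((((PadicInt.toZModPow (n + cyclotomicExponent p) ((η : ℤ_[p]ˣ) : ℤ_[p]) *
              (cyclotomicGenerator p : ZMod (p ^ (n + cyclotomicExponent p))) ^ s.val).val : ℚ) /
                (p : ℚ) ^ (n + cyclotomicExponent p)) *
              ((∏ v : S₀, natGenerator (v : IsDedekindDomain.HeightOneSpectrum (NumberField.RingOfIntegers ℚ)) ^ (k v) : ℕ) :
                ℚ))))) * (X + 1) ^ s.val := by
  haveI : NeZero (p ^ n) := ⟨pow_ne_zero _ hp.out.ne_zero⟩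
  obtain ⟨hmonic, -⟩ := monic_layerModulus_and_natDegree (K := PadicAlgCl p) (p ^ n)
  have hper : ∀ (x : ℚ) (k : ℤ), algebraMap ℚ (PadicAlgCl p) (ratPlusSymbol f (x + k)) =
      algebraMap ℚ (PadicAlgCl p) (ratPlusSymbol f x) := fun x k ↦ by rw [ratPlusSymbol_add_intCast_eq]
  have hcop : ∀ v ∈ S₀, (natGenerator v).Coprime p := fun v hv ↦ (coprime_natGenerator v (hS v hv)).1.symm
  have h := layerSum_mul_prod_eulerFactor_congr' (p := p) (fun x ↦ algebraMap ℚ (PadicAlgCl p) (ratPlusSymbol f x)) hper S₀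
    (fun v ↦ natGenerator v) hcop (fun v ↦ (W.localPolynomialAt v).map (Int.castRingHom (PadicAlgCl p)))
    (d := 2) (fun v _ ↦ (natDegree_map_le).trans (WeierstrassCurve.natDegree_localPolynomial_le_two _)) n
  rw [map_mazurTateElement_eq_layerSum, modByMonic_eq_of_dvd_sub hmonic h]
  exact layerSum_modByMonic_layerModulus' (K := PadicAlgCl p) (fun t ↦ ∑ᶠ η : rootsOfUnity (torsionOrder p) ℤ_[p],
    (∑ k ∈ Fintype.piFinset (fun _ : S₀ ↦ Finset.range (2 + 1)),
      (∏ v : S₀, ((W.localPolynomialAt (v : IsDedekindDomain.HeightOneSpectrum (NumberField.RingOfIntegers ℚ))).map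
          (Int.castRingHom (PadicAlgCl p))).coeff (k v) *
        ((natGenerator (v : IsDedekindDomain.HeightOneSpectrum (NumberField.RingOfIntegers ℚ)) : PadicAlgCl p)⁻¹) ^ (k v)) *
      algebraMap ℚ (PadicAlgCl p) (ratPlusSymbol f
        ((((PadicInt.toZModPow (n + cyclotomicExponent p) ((η : ℤ_[p]ˣ) : ℤ_[p]) *
          (cyclotomicGenerator p : ZMod (p ^ (n + cyclotomicExponent p))) ^ t).val : ℚ) /
            (p : ℚ) ^ (n + cyclotomicExponent p)) *
          ((∏ v : S₀, natGenerator (v : IsDedekindDomain.HeightOneSpectrum (NumberField.RingOfIntegers ℚ)) ^ (k v) : ℕ) : ℚ))))) (p ^ n)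

/-- ★ **The partner's `S₀`-depleted layer polynomial of the stub is EXACTLY the layer sum of the `S₀`-DEPLETED plus symbol
`ι[·]⁺_{g,Ω}`** (any prime `p`). For a newform datum `(g, Ω, ι)` on `Γ₀(N)`, a level `M`, a finite set `S₀` of places not above
`p`, and every layer `n`:
`(θ_n(g;Ω)^ι · ∏_{v∈S₀} (1 − ι a_{ℓ_v} X + 𝟙_{ℓ_v∤M} ℓ_v X²) ∘ (ℓ_v⁻¹(1+X)^{e_v})) mod ω_n = ϑ_n(φ^{S₀}_{g,Ω})`,
`φ^{S₀}_{g,Ω}(x) = ∑_{k : S₀ → {0,1,2}} (∏_v c_{v,k_v} ℓ_v^{−k_v}) · ι[x·∏_v ℓ_v^{k_v}]⁺_{g,Ω}`.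
Port of the tree's `p = 2` theorem `depletedPartnerLayer_eq_layerSum_depletedSymbol`.
[cite: GreenbergVatsal2000, §1 p. 9 (display (8))] [cite: PollackWeston2011MT, §2.2] -/
theorem depletedPartnerLayer_eq_layerSum_depletedSymbol' (g : CuspForm (CongruenceSubgroup.Gamma0 N) 2) (Ω : ℂ)
    (ι : coeffField g →+* PadicAlgCl p) (n M : ℕ)
    (S₀ : Finset (IsDedekindDomain.HeightOneSpectrum (NumberField.RingOfIntegers ℚ)))
    (hS : ∀ v ∈ S₀, natGenerator v ≠ p) :
    ((mazurTateElementK g Ω p n).map ι *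
        ∏ v ∈ S₀, (1 - C (embCoeff g ι (natGenerator v)) * X +
            (if natGenerator v ∣ M then 0 else C (natGenerator v : PadicAlgCl p)) * X ^ 2).comp
          (C ((natGenerator v : PadicAlgCl p)⁻¹) *
            (X + 1) ^ (PadicInt.toZModPow n (-(frobeniusExponent p (natGenerator v : ℤ_[p])))).val)) %ₘ
        ((X + 1) ^ p ^ n - 1) =
      ∑ s : ZMod (p ^ n), C (∑ᶠ η : rootsOfUnity (torsionOrder p) ℤ_[p],
        (∑ k ∈ Fintype.piFinset (fun _ : S₀ ↦ Finset.range 3),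
          (∏ v : S₀, (1 - C (embCoeff g ι (natGenerator (v : IsDedekindDomain.HeightOneSpectrum (NumberField.RingOfIntegers ℚ)))) * X +
              (if natGenerator (v : IsDedekindDomain.HeightOneSpectrum (NumberField.RingOfIntegers ℚ)) ∣ M then 0
                else C (natGenerator (v : IsDedekindDomain.HeightOneSpectrum (NumberField.RingOfIntegers ℚ)) : PadicAlgCl p)) *
                X ^ 2 : (PadicAlgCl p)[X]).coeff (k v) *
            ((natGenerator (v : IsDedekindDomain.HeightOneSpectrum (NumberField.RingOfIntegers ℚ)) : PadicAlgCl p)⁻¹) ^ (k v)) *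
          ι (plusSymbolK g Ω
            ((((PadicInt.toZModPow (n + cyclotomicExponent p) ((η : ℤ_[p]ˣ) : ℤ_[p]) *
              (cyclotomicGenerator p : ZMod (p ^ (n + cyclotomicExponent p))) ^ s.val).val : ℚ) /
                (p : ℚ) ^ (n + cyclotomicExponent p)) *
              ((∏ v : S₀, natGenerator (v : IsDedekindDomain.HeightOneSpectrum (NumberField.RingOfIntegers ℚ)) ^ (k v) : ℕ) :
                ℚ))))) * (X + 1) ^ s.val := by
  haveI : NeZero (p ^ n) := ⟨pow_ne_zero _ hp.out.ne_zero⟩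
  obtain ⟨hmonic, -⟩ := monic_layerModulus_and_natDegree (K := PadicAlgCl p) (p ^ n)
  have hper : ∀ (x : ℚ) (k : ℤ), ι (plusSymbolK g Ω (x + k)) = ι (plusSymbolK g Ω x) := fun x k ↦ by
    rw [plusSymbolK_add_intCast]
  have hcop : ∀ v ∈ S₀, (natGenerator v).Coprime p := fun v hv ↦ (coprime_natGenerator v (hS v hv)).1.symm
  have h := layerSum_mul_prod_eulerFactor_congr' (p := p) (fun x ↦ ι (plusSymbolK g Ω x)) hper S₀
    (fun v ↦ natGenerator v) hcop
    (fun v ↦ (1 - C (embCoeff g ι (natGenerator v)) * X +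
      (if natGenerator v ∣ M then 0 else C (natGenerator v : PadicAlgCl p)) * X ^ 2 : (PadicAlgCl p)[X]))
    (d := 2) (fun v _ ↦ natDegree_partnerEulerPolynomial_le _ _ _) n
  rw [map_mazurTateElementK_eq_layerSum, modByMonic_eq_of_dvd_sub hmonic h]
  exact layerSum_modByMonic_layerModulus' (K := PadicAlgCl p) (fun t ↦ ∑ᶠ η : rootsOfUnity (torsionOrder p) ℤ_[p],
    (∑ k ∈ Fintype.piFinset (fun _ : S₀ ↦ Finset.range (2 + 1)),
      (∏ v : S₀, (1 - C (embCoeff g ι (natGenerator (v : IsDedekindDomain.HeightOneSpectrum (NumberField.RingOfIntegers ℚ)))) * X +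
          (if natGenerator (v : IsDedekindDomain.HeightOneSpectrum (NumberField.RingOfIntegers ℚ)) ∣ M then 0
            else C (natGenerator (v : IsDedekindDomain.HeightOneSpectrum (NumberField.RingOfIntegers ℚ)) : PadicAlgCl p)) *
            X ^ 2 : (PadicAlgCl p)[X]).coeff (k v) *
        ((natGenerator (v : IsDedekindDomain.HeightOneSpectrum (NumberField.RingOfIntegers ℚ)) : PadicAlgCl p)⁻¹) ^ (k v)) *
      ι (plusSymbolK g Ω
        ((((PadicInt.toZModPow (n + cyclotomicExponent p) ((η : ℤ_[p]ˣ) : ℤ_[p]) *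
          (cyclotomicGenerator p : ZMod (p ^ (n + cyclotomicExponent p))) ^ t).val : ℚ) /
            (p : ℚ) ^ (n + cyclotomicExponent p)) *
          ((∏ v : S₀, natGenerator (v : IsDedekindDomain.HeightOneSpectrum (NumberField.RingOfIntegers ℚ)) ^ (k v) : ℕ) : ℚ))))) (p ^ n)

end Stub

end Summit.BirchSwinnertonDyer.BirchSwinnertonDyer.Theorems.SmallImageRttKan

end
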